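import Literature.MathematicalPhysics.QuantumLattice.YangMillsHodgeDualField
import HarnessLib

/-!
# Local gauge covariance: curvature, covariant derivatives and the Hodge-dual field

QuantumLattice support file (everything proved; no definitions, no named facts) on the proof
path of `Literature.MathematicalPhysics.QuantumLattice.Waldron2019_yangMillsFlow_flatTorus`
(A. Waldron, Invent. math. 217 (2019)), Lemma 3.5 / §4. The tree's `curvature_gaugeAct_holds`
needs a GLOBAL `C²` field of units; the glued gauge of `GluedConnection` is only defined on a
shell, so we prove the LOCAL statements: for `g, gi` of class `C²` on an open set `U ∋ x` with
`gi g = 1 = g gi` on `U`, and a connection `B` which on `U` equals `gi A g + gi dg`,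

* `fderiv_inverse_pair` — `D(gi)(u) = −gi Dg(u) gi`;
* `curvature_conj_local` — **`F_B(x)(u,v) = gi(x) F_A(x)(u,v) g(x)`**;
* `covDeriv_conj_local` — `D^B(gi φ g)(x)(v) = gi (D^A φ)(x)(v) g`;
* `hodgeSec_conj_local` — `hodgeSec e B a = gi (hodgeSec e A a) g` on `U`;
* `covDeriv_hodgeSec_conj_local` — `D^B_v (hodgeSec e B a)(x) = gi (D^A_v hodgeSec e A a)(x) g`.

References: A. Waldron, Invent. math. 217 (2019), §4 [Waldron2019]; Donaldson–Kronheimer (2.1.8)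
[folklore].
-/

noncomputable section

open scoped RealInnerProductSpace Topology
open Set Filter Literature.Analysis.InnerProduct

namespace Literature.MathematicalPhysics.QuantumLattice

section Local

variable {E : Type*} [NormedAddCommGroup E] [InnerProductSpace ℝ E]
variable {𝔸 : Type*} [NormedRing 𝔸] [NormedAlgebra ℝ 𝔸]

/-- **Derivative of a pointwise inverse**: if `gi g = 1 = g gi` near `x` and both are
differentiable at `x`, then `D(gi)(u) = −gi Dg(u) gi`. [folklore] -/
theorem fderiv_inverse_pair {g gi : E → 𝔸} {x : E} (hg : DifferentiableAt ℝ g x)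
    (hgi : DifferentiableAt ℝ gi x) (h1 : ∀ᶠ y in 𝓝 x, gi y * g y = 1) (h2 : g x * gi x = 1) (u : E) :
    fderiv ℝ gi x u = -(gi x * fderiv ℝ g x u * gi x) := by
  -- differentiate `gi g = 1`
  have hprod : HasFDerivAt (fun y => gi y * g y) (gi x • fderiv ℝ g x + MulOpposite.op (g x) • fderiv ℝ gi x) x :=
    hgi.hasFDerivAt.mul' hg.hasFDerivAt
  have hconst : fderiv ℝ (fun y => gi y * g y) x = 0 := by
    rw [Filter.EventuallyEq.fderiv_eq (h1.mono fun y hy => hy), fderiv_fun_const]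
    rfl
  have h := congrArg (fun L : E →L[ℝ] 𝔸 => L u) hprod.fderiv
  simp only [hconst, zero_apply, add_apply, smul_apply, smul_eq_mul, MulOpposite.smul_eq_mul_unop,
    MulOpposite.unop_op] at h
  -- `0 = gi Dg u + Dgi u g`; multiply by `gi` on the right
  have h3 : fderiv ℝ gi x u * g x = -(gi x * fderiv ℝ g x u) := by
    rw [eq_neg_iff_add_eq_zero, add_comm]; exact h.symm
  calc fderiv ℝ gi x u = fderiv ℝ gi x u * (g x * gi x) := by rw [h2, mul_one]
    _ = (fderiv ℝ gi x u * g x) * gi x := by rw [mul_assoc]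
    _ = -(gi x * fderiv ℝ g x u * gi x) := by rw [h3, neg_mul]

/-- **Local gauge covariance of the curvature.** [folklore] -/
theorem curvature_conj_local {g gi : E → 𝔸} {U : Set E} (hU : IsOpen U) {x : E} (hx : x ∈ U)
    (hg : ContDiffOn ℝ 2 g U) (hgi : ContDiffOn ℝ 2 gi U)
    (hinv : ∀ y ∈ U, gi y * g y = 1 ∧ g y * gi y = 1)
    {A B : Connection E 𝔸} (hA : Differentiable ℝ A)
    (hB : ∀ y ∈ U, ∀ w, B y w = gi y * A y w * g y + gi y * fderiv ℝ g y w) (u v : E) :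
    curvature B x u v = gi x * curvature A x u v * g x := by
  have hUx : U ∈ 𝓝 x := hU.mem_nhds hx
  have hgx : ContDiffAt ℝ 2 g x := hg.contDiffAt hUx
  have hgix : ContDiffAt ℝ 2 gi x := hgi.contDiffAt hUx
  have hgd : DifferentiableAt ℝ g x := hgx.differentiableAt (by norm_num)
  have hgid : DifferentiableAt ℝ gi x := hgix.differentiableAt (by norm_num)
  -- `fderiv g` is differentiable at `x`
  have hDg : DifferentiableAt ℝ (fderiv ℝ g) x := by
    have h := (hg.fderiv_of_isOpen hU (m := 1) (by norm_num)).differentiableOn one_ne_zero x hx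
    exact h.differentiableAt hUx
  have hsymm : fderiv ℝ (fderiv ℝ g) x u v = fderiv ℝ (fderiv ℝ g) x v u :=
    hgx.isSymmSndFDerivAt (by simp [minSmoothness_of_isRCLikeNormedField]) u v
  have hev1 : ∀ᶠ y in 𝓝 x, gi y * g y = 1 := Filter.eventually_of_mem hUx fun y hy => (hinv y hy).1
  have hDgi : ∀ w, fderiv ℝ gi x w = -(gi x * fderiv ℝ g x w * gi x) :=
    fderiv_inverse_pair hgd hgid hev1 (hinv x hx).2
  -- the components of `B` near `x`
  have hBfun : ∀ w, (fun y => B y w) =ᶠ[𝓝 x] fun y => gi y * A y w * g y + gi y * fderiv ℝ g y w :=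
    fun w => Filter.eventually_of_mem hUx fun y hy => hB y hy w
  -- their derivatives
  have hderiv : ∀ w w', fderiv ℝ (fun y => B y w) x w' =
      fderiv ℝ gi x w' * A x w * g x + gi x * fderiv ℝ (fun y => A y w) x w' * g x +
        gi x * A x w * fderiv ℝ g x w' +
        (fderiv ℝ gi x w' * fderiv ℝ g x w + gi x * fderiv ℝ (fderiv ℝ g) x w' w) := by
    intro w w'
    rw [(hBfun w).fderiv_eq]
    have h1 := hgid.hasFDerivAt
    have h2 : HasFDerivAt (fun y => A y w) (fderiv ℝ (fun y => A y w) x) x :=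
      ((hA x).clm_apply (differentiableAt_const w)).hasFDerivAt
    have h3 := hgd.hasFDerivAt
    have h4 : HasFDerivAt (fun y => fderiv ℝ g y w) ((fderiv ℝ (fderiv ℝ g) x).flip w) x := by
      have := hDg.hasFDerivAt.clm_apply (hasFDerivAt_const w x)
      simpa using this
    have h5 := ((h1.fun_mul' h2).fun_mul' h3).fun_add (h1.fun_mul' h4)
    rw [h5.fderiv]
    simp only [add_apply, smul_apply, smul_eq_mul, MulOpposite.smul_eq_mul_unop, MulOpposite.unop_op,
      ContinuousLinearMap.flip_apply]
    noncomm_ring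
  simp only [curvature]
  rw [hderiv v u, hderiv u v, hsymm, hB x hx u, hB x hx v, hDgi u, hDgi v]
  simp only [Ring.lie_def]
  -- cancel with `g gi = 1`: `G = g x` is a unit with inverse `Gi = gi x`
  have e := (hinv x hx).2
  set G := g x
  set Gi := gi x
  obtain ⟨w, hw⟩ : IsUnit G := isUnit_iff_exists.2 ⟨Gi, e, (hinv x hx).1⟩
  have hwi : ((w⁻¹ : 𝔸ˣ) : 𝔸) = Gi := by
    calc ((w⁻¹ : 𝔸ˣ) : 𝔸) = ((w⁻¹ : 𝔸ˣ) : 𝔸) * (G * Gi) := by rw [e, mul_one]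
      _ = Gi := by rw [← hw, ← mul_assoc, Units.inv_mul, one_mul]
  rw [← hw, ← hwi]
  simp only [mul_sub, sub_mul, mul_add, add_mul, mul_assoc, Units.mul_inv_cancel_left, neg_mul]
  abel

/-- **Local gauge covariance of covariant derivatives**: `D^B_v(gi φ g)(x) = gi (D^A_v φ)(x) g`.
[folklore] -/
theorem covDeriv_conj_local {g gi : E → 𝔸} {x : E} (hg : DifferentiableAt ℝ g x)
    (hgi : DifferentiableAt ℝ gi x) (h1 : ∀ᶠ y in 𝓝 x, gi y * g y = 1) (h2 : g x * gi x = 1)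
    {A B : Connection E 𝔸} (hB : ∀ w, B x w = gi x * A x w * g x + gi x * fderiv ℝ g x w)
    {φ : E → 𝔸} (hφ : DifferentiableAt ℝ φ x) (v : E) :
    covDeriv B (fun y => gi y * φ y * g y) x v = gi x * covDeriv A φ x v * g x := by
  have hDgi := fderiv_inverse_pair hg hgi h1 h2 v
  have hprod := ((hgi.hasFDerivAt.fun_mul' hφ.hasFDerivAt).fun_mul' hg.hasFDerivAt)
  unfold covDeriv
  rw [hprod.fderiv, hB v]
  simp only [add_apply, smul_apply, smul_eq_mul, MulOpposite.smul_eq_mul_unop, MulOpposite.unop_op,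
    Ring.lie_def, hDgi]
  obtain ⟨w, hw⟩ : IsUnit (g x) := isUnit_iff_exists.2 ⟨gi x, h2, h1.self_of_nhds⟩
  have hwi : ((w⁻¹ : 𝔸ˣ) : 𝔸) = gi x := by
    calc ((w⁻¹ : 𝔸ˣ) : 𝔸) = ((w⁻¹ : 𝔸ˣ) : 𝔸) * (g x * gi x) := by rw [h2, mul_one]
      _ = gi x := by rw [← hw, ← mul_assoc, Units.inv_mul, one_mul]
  rw [← hw, ← hwi]
  simp only [mul_sub, sub_mul, mul_add, add_mul, mul_assoc, Units.mul_inv_cancel_left, neg_mul]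
  abel

/-- **The Hodge-dual sections transform by conjugation** where the curvature does. [folklore] -/
theorem hodgeSec_conj_of_curvature (e : OrthonormalBasis (Fin 4) ℝ E) {A B : Connection E 𝔸} {y : E}
    {G Gi : 𝔸} (hF : ∀ u v, curvature B y u v = Gi * curvature A y u v * G) (a : Fin 4) :
    hodgeSec e B a y = Gi * hodgeSec e A a y * G := by
  unfold hodgeSec
  simp only [hF, Finset.mul_sum, Finset.sum_mul, mul_smul_comm, smul_mul_assoc, mul_assoc]

/-- **Local covariance of `D_v u_a`**: with `g, gi ∈ C²` on an open `U ∋ x`, `gi g = 1 = g gi` on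
`U`, `A ∈ C²`, and `B = gi A g + gi dg` on `U`,
`D^B_v (hodgeSec e B a)(x) = gi(x) (D^A_v hodgeSec e A a)(x) g(x)`. [folklore] -/
theorem covDeriv_hodgeSec_conj_local (eb : OrthonormalBasis (Fin 4) ℝ E) {g gi : E → 𝔸} {U : Set E}
    (hU : IsOpen U) {x : E} (hx : x ∈ U) (hg : ContDiffOn ℝ 2 g U) (hgi : ContDiffOn ℝ 2 gi U)
    (hinv : ∀ y ∈ U, gi y * g y = 1 ∧ g y * gi y = 1)
    {A B : Connection E 𝔸} (hA : ContDiff ℝ 2 A)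
    (hB : ∀ y ∈ U, ∀ w, B y w = gi y * A y w * g y + gi y * fderiv ℝ g y w) (a : Fin 4) (v : E) :
    covDeriv B (hodgeSec eb B a) x v = gi x * covDeriv A (hodgeSec eb A a) x v * g x := by
  have hUx : U ∈ 𝓝 x := hU.mem_nhds hx
  have hAd : Differentiable ℝ A := hA.differentiable two_ne_zero
  -- `hodgeSec B = gi (hodgeSec A) g` on `U`
  have hev : hodgeSec eb B a =ᶠ[𝓝 x] fun y => gi y * hodgeSec eb A a y * g y :=
    Filter.eventually_of_mem hUx fun y hy =>
      hodgeSec_conj_of_curvature eb (fun u w => curvature_conj_local hU hy hg hgi hinv hAd hB u w) a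
  have hcov : covDeriv B (hodgeSec eb B a) x v = covDeriv B (fun y => gi y * hodgeSec eb A a y * g y) x v := by
    unfold covDeriv
    rw [hev.fderiv_eq, hev.self_of_nhds]
  rw [hcov]
  have hgd : DifferentiableAt ℝ g x := (hg.contDiffAt hUx).differentiableAt (by norm_num)
  have hgid : DifferentiableAt ℝ gi x := (hgi.contDiffAt hUx).differentiableAt (by norm_num)
  -- `hodgeSec A a` is differentiable (`A ∈ C²`)
  have hA' : ContDiff ℝ ((1 : WithTop ℕ∞) + 1) A := by
    rw [show ((1 : WithTop ℕ∞) + 1) = 2 by norm_num]; exact hA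
  have hφ : DifferentiableAt ℝ (hodgeSec eb A a) x := by
    have hF : ∀ c d, Differentiable ℝ (fun y => curvature A y (eb c) (eb d)) := fun c d =>
      (contDiff_curvature_apply (k := 1) hA' (eb c) (eb d)).differentiable one_ne_zero
    unfold hodgeSec
    have hterm : ∀ b c d, DifferentiableAt ℝ
        (fun y : E => (((lc4 a b c d : ℤ) : ℝ) * ⟪y, eb b⟫) • curvature A y (eb c) (eb d)) x :=
      fun b c d => ((differentiableAt_id.inner ℝ (differentiableAt_const (eb b))).const_mul _).smul (hF c d x)
    have hs3 : ∀ b c, DifferentiableAt ℝ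
        (fun y : E => ∑ d, (((lc4 a b c d : ℤ) : ℝ) * ⟪y, eb b⟫) • curvature A y (eb c) (eb d)) x :=
      fun b c => by
        have := DifferentiableAt.fun_sum (u := Finset.univ) fun d _ => hterm b c d
        simpa using this
    have hs2 : ∀ b, DifferentiableAt ℝ
        (fun y : E => ∑ c, ∑ d, (((lc4 a b c d : ℤ) : ℝ) * ⟪y, eb b⟫) • curvature A y (eb c) (eb d)) x :=
      fun b => by
        have := DifferentiableAt.fun_sum (u := Finset.univ) fun c _ => hs3 b c
        simpa using this
    have hs1 : DifferentiableAt ℝ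
        (fun y : E => ∑ b, ∑ c, ∑ d, (((lc4 a b c d : ℤ) : ℝ) * ⟪y, eb b⟫) • curvature A y (eb c) (eb d)) x := by
      have := DifferentiableAt.fun_sum (u := Finset.univ) fun b _ => hs2 b
      simpa using this
    exact hs1.fun_const_smul _
  exact covDeriv_conj_local hgd hgid (Filter.eventually_of_mem hUx fun y hy => (hinv y hy).1)
    (hinv x hx).2 (hB x hx) hφ v

end Local

end Literature.MathematicalPhysics.QuantumLattice
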